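import Mathlib
import Summits.CriticalPhenomena.Ising3DConformalLimit.Theorems.PrecisionLaplacianEtaBoundsTransferTrig
import Summits.CriticalPhenomena.Ising3DConformalLimit.Theorems.PrecisionLaplacianEtaBoundsTransferOrtho
import Summits.CriticalPhenomena.Ising3DConformalLimit.Theorems.PrecisionLaplacianDirectCorrelationStableTailSpectralBallMass
import Literature.Probability.LatticeModels.SharpnessProofs
import HarnessLib

/-!
# Stub `stub_spectralTailBound` of line `diffusive-branch-is-nonsaturation` (crux
# `PrecisionLaplacian.DirectCorrelationStableTail`, stmt-CriticalPhenomena-4799): the box block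
# weight sees little spectral mass outside a small cube

**Statement** (registered text, = `stub_spectralTailBound` of the lead's skeleton).  Let
`g̃_L(k) = Σ_{z,z'∈Λ_L} G(z'−z) cos(k·(z'−z)) ≥ 0` (`Λ_L = box 3 L`) be the approximate spectral
density on the cube `K = [-π,π]³`, with small-cube masses `∫_{K_ρ} g̃_L ≤ C_M ρ (2L+1)³` for
`0 < ρ ≤ 1` (`K_ρ = [-ρ,ρ]³`) and total mass `∫_K g̃_L ≤ C_T (2L+1)³`.  Then for `0 < ρ₂ ≤ 1` the box
block weight `W_R(k) = Σ_{x,x'∈Λ_R} cos(k·(x'−x)) = (∏_j D_R(k_j))²` satisfies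
`∫_{K ∖ K_{ρ₂}} W_R g̃_L ≤ (40 C_M + 60 C_T) (2R+1)⁴ ρ₂⁻¹ (2L+1)³`.

**Proof.**  *Pointwise* (`spectralTailBound_weight_le`): if `k ∈ K ∖ K_ρ`, `ρ > 0`, some coordinate
has `ρ < |k_{j₀}| ≤ π`, so `D_R(k_{j₀})² ≤ π²/ρ²` (`abs_dirichletRowSum_le_pi_div`) while the two other
factors are `≤ (2R+1)²` (`abs_dirichletRowSum_le`): `W_R(k) ≤ π² (2R+1)⁴ / ρ²`.
*Dyadic induction* (`spectralTailBound_induction`, abstract in the cube family `K_ρ` and in `W, g`):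
with `c = π²(2R+1)⁴`, `N = (2L+1)³`, we show `∫_{K∖K_ρ} W g ≤ 4c C_M N/ρ + 4c C_T N` whenever
`ρ ≥ 2^{-(J+1)}`, by induction on `J`.  For `ρ ≥ 1/2` the weight is `≤ 4c` on `K ∖ K_ρ`, so the
integral is `≤ 4c ∫_K g ≤ 4c C_T N`.  For `ρ < 1/2` split `K ∖ K_ρ` along `K_{2ρ}`
(`integral_inter_add_sdiff`): the far part `(K∖K_ρ)∖K_{2ρ} ⊆ K∖K_{2ρ}` is handled by the induction
hypothesis at `2ρ`, and on the near part `(K∖K_ρ) ∩ K_{2ρ}` the weight is `≤ c/ρ²` while the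
`g`-mass is `≤ ∫_{K_{2ρ}} g ≤ C_M (2ρ) N` (`2ρ ≤ 1`); and `(c/ρ²)·2C_Mρ N + 4cC_M N/(2ρ) = 4cC_M N/ρ`.
Finally `2^{-(J+1)} ≤ ρ₂` for some `J` (`exists_pow_lt_of_lt_one`), `4π² ≤ 40` (`Real.pi_lt_d2`)
and `4c C_T N ≤ 40 C_T (2R+1)⁴ N ≤ 60 C_T (2R+1)⁴ N/ρ₂` as `ρ₂ ≤ 1`.

Pure theorem file, no definitions, no `sorry`.  [folklore]
-/

noncomputable section

namespace Summit.CriticalPhenomena.Ising3DConformalLimit.Cruxes.DirectCorrelationStableTail.DiffusiveBranchIsNonsaturation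

open MeasureTheory Filter Topology
open scoped BigOperators
open Literature.Probability.LatticeModels
open Literature.Barriers.CriticalPhenomena.SpreadOutIsing (dirichletRowSum abs_dirichletRowSum_le)
open Summit.CriticalPhenomena.Ising3DConformalLimit.Theorems

/-! ### The block weight away from the origin -/

/-- **Pointwise decay of the block weight**: for `k ∈ [-π,π]³` outside `[-ρ,ρ]³` (`ρ > 0`),
`Σ_{x,x'∈Λ_R} cos(k·(x'−x)) = (∏_j D_R(k_j))² ≤ π² (2R+1)⁴ / ρ²` — the coordinate `j₀` with
`|k_{j₀}| > ρ` contributes `D_R(k_{j₀})² ≤ (π/|k_{j₀}|)² ≤ π²/ρ²`, the other two at most `(2R+1)²`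
each. [folklore] -/
theorem spectralTailBound_weight_le (R : ℕ) {ρ : ℝ} (hρ : 0 < ρ) {k : Fin 3 → ℝ}
    (hk : k ∈ Set.pi Set.univ (fun _ : Fin 3 => Set.Icc (-Real.pi) Real.pi))
    (hkρ : k ∉ Set.pi Set.univ (fun _ : Fin 3 => Set.Icc (-ρ) ρ)) :
    ∑ x ∈ box 3 R, ∑ x' ∈ box 3 R, Real.cos (phase 3 k (x' - x))
      ≤ Real.pi ^ 2 * (2 * R + 1) ^ 4 / ρ ^ 2 := by
  classical
  rw [spectralBallMass_weight_eq, ← Finset.prod_pow]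
  rw [Set.mem_univ_pi] at hk
  have hk' : ∀ j, |k j| ≤ Real.pi := fun j => abs_le.2 (hk j)
  -- a coordinate carrying more than `ρ`
  obtain ⟨j₀, hj₀⟩ : ∃ j₀, ρ < |k j₀| := by
    by_contra h
    apply hkρ
    rw [Set.mem_univ_pi]
    intro j
    rw [Set.mem_Icc, ← abs_le]
    exact le_of_not_gt fun hlt => h ⟨j, hlt⟩
  have hkj₀ : k j₀ ≠ 0 := by
    intro h0
    rw [h0, abs_zero] at hj₀
    exact lt_irrefl _ (hρ.trans hj₀)
  rw [← Finset.mul_prod_erase Finset.univ (fun j => dirichletRowSum R (k j) ^ 2) (Finset.mem_univ j₀)]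
  have h1 : dirichletRowSum R (k j₀) ^ 2 ≤ Real.pi ^ 2 / ρ ^ 2 := by
    rw [← div_pow, ← sq_abs]
    refine pow_le_pow_left₀ (abs_nonneg _) ?_ 2
    calc |dirichletRowSum R (k j₀)| ≤ Real.pi / |k j₀| :=
          EtaBoundsTransfer.abs_dirichletRowSum_le_pi_div R hkj₀ (hk' j₀)
      _ ≤ Real.pi / ρ := div_le_div_of_nonneg_left Real.pi_pos.le hρ hj₀.le
  have h2 : ∏ j ∈ Finset.univ.erase j₀, dirichletRowSum R (k j) ^ 2 ≤ ((2 * R + 1 : ℝ) ^ 2) ^ 2 := by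
    calc ∏ j ∈ Finset.univ.erase j₀, dirichletRowSum R (k j) ^ 2
        ≤ ∏ _j ∈ Finset.univ.erase j₀, (2 * R + 1 : ℝ) ^ 2 :=
          Finset.prod_le_prod (fun j _ => sq_nonneg _) fun j _ => by
            rw [← sq_abs]
            exact pow_le_pow_left₀ (abs_nonneg _) (abs_dirichletRowSum_le R (k j)) 2
      _ = ((2 * R + 1 : ℝ) ^ 2) ^ 2 := by
          rw [Finset.prod_const, Finset.card_erase_of_mem (Finset.mem_univ j₀), Finset.card_univ,
            Fintype.card_fin]
  calc dirichletRowSum R (k j₀) ^ 2 * ∏ j ∈ Finset.univ.erase j₀, dirichletRowSum R (k j) ^ 2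
      ≤ Real.pi ^ 2 / ρ ^ 2 * ((2 * R + 1 : ℝ) ^ 2) ^ 2 :=
        mul_le_mul h1 h2 (Finset.prod_nonneg fun j _ => sq_nonneg _) (by positivity)
    _ = Real.pi ^ 2 * (2 * R + 1) ^ 4 / ρ ^ 2 := by ring

/-- The approximate spectral density `k ↦ Σ_{z,z'∈Λ_L} G(z'−z) cos(k·(z'−z))` is continuous.
[folklore] -/
theorem spectralTailBound_continuous_density (L : ℕ) (G : Site 3 → ℝ) :
    Continuous fun k : Fin 3 → ℝ =>
      ∑ z ∈ box 3 L, ∑ z' ∈ box 3 L, G (z' - z) * Real.cos (phase 3 k (z' - z)) :=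
  continuous_finsetSum _ fun _ _ => continuous_finsetSum _ fun _ _ =>
    continuous_const.mul (Real.continuous_cos.comp (EtaBoundsTransfer.continuous_phase _))

/-- The box block weight `k ↦ Σ_{x,x'∈Λ_R} cos(k·(x'−x))` is continuous. [folklore] -/
theorem spectralTailBound_continuous_weight (R : ℕ) :
    Continuous fun k : Fin 3 → ℝ => ∑ x ∈ box 3 R, ∑ x' ∈ box 3 R, Real.cos (phase 3 k (x' - x)) :=
  continuous_finsetSum _ fun _ _ => continuous_finsetSum _ fun _ _ =>
    Real.continuous_cos.comp (EtaBoundsTransfer.continuous_phase _)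

/-! ### The abstract dyadic induction -/

/-- **Abstract tail bound by dyadic induction.**  Let `K_r ⊆ ℝ³` (`r : ℝ`) be compact measurable
sets, `W, g ≥ 0` continuous, `c ≥ 0`, `W ≤ c/ρ²` on `K_π ∖ K_ρ` for every `ρ > 0`,
`∫_{K_ρ} g ≤ C_M ρ N` for `0 < ρ ≤ 1` and `∫_{K_π} g ≤ C_T N` (`C_M, N ≥ 0`).  Then for every `J : ℕ`
and every `ρ ≥ 2^{-(J+1)}`, `∫_{K_π ∖ K_ρ} W g ≤ 4c C_M N/ρ + 4c C_T N`: for `ρ ≥ 1/2` directly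
(`W ≤ 4c`), for `ρ < 1/2` by splitting along `K_{2ρ}` and the induction hypothesis at `2ρ`.
(Used with `K_r = [-r,r]³`.) [folklore] -/
theorem spectralTailBound_induction {K : ℝ → Set (Fin 3 → ℝ)} {W g : (Fin 3 → ℝ) → ℝ}
    {c C_M C_T N : ℝ} (hKm : ∀ r, MeasurableSet (K r)) (hKc : ∀ r, IsCompact (K r))
    (hWc : Continuous W) (hgc : Continuous g) (hW0 : ∀ k, 0 ≤ W k) (hg0 : ∀ k, 0 ≤ g k)
    (hc : 0 ≤ c) (hCM : 0 ≤ C_M) (hN : 0 ≤ N)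
    (hWle : ∀ (ρ : ℝ) (k : Fin 3 → ℝ), 0 < ρ → k ∈ K Real.pi → k ∉ K ρ → W k ≤ c / ρ ^ 2)
    (hM : ∀ ρ : ℝ, 0 < ρ → ρ ≤ 1 → ∫ k in K ρ, g k ≤ C_M * ρ * N)
    (hT : ∫ k in K Real.pi, g k ≤ C_T * N) :
    ∀ (J : ℕ) (ρ : ℝ), 1 / 2 * (1 / 2) ^ J ≤ ρ →
      ∫ k in K Real.pi \ K ρ, W k * g k ≤ 4 * c * (C_M * N) / ρ + 4 * c * (C_T * N) := by
  -- integrability, nonnegativity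
  have hfi : ∀ s : Set (Fin 3 → ℝ), s ⊆ K Real.pi →
      IntegrableOn (fun k => W k * g k) s volume := fun s hs =>
    ((hWc.mul hgc).continuousOn.integrableOn_compact (hKc Real.pi)).mono_set hs
  have hgi : ∀ r : ℝ, IntegrableOn g (K r) volume := fun r =>
    hgc.continuousOn.integrableOn_compact (hKc r)
  have hf0 : ∀ k, 0 ≤ W k * g k := fun k => mul_nonneg (hW0 k) (hg0 k)
  -- the base case `ρ ≥ 1/2`
  have base : ∀ ρ : ℝ, 1 / 2 ≤ ρ →
      ∫ k in K Real.pi \ K ρ, W k * g k ≤ 4 * c * (C_M * N) / ρ + 4 * c * (C_T * N) := by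
    intro ρ hρ
    have hρ0 : 0 < ρ := by linarith
    have hS : MeasurableSet (K Real.pi \ K ρ) := (hKm _).diff (hKm _)
    have h1 : ∫ k in K Real.pi \ K ρ, W k * g k ≤ 4 * c * (C_T * N) := by
      calc ∫ k in K Real.pi \ K ρ, W k * g k
          ≤ ∫ k in K Real.pi \ K ρ, 4 * c * g k := by
            refine setIntegral_mono_on (hfi _ Set.sdiff_subset)
              (Integrable.const_mul ((hgi Real.pi).mono_set Set.sdiff_subset) _) hS ?_
            intro k hk
            refine mul_le_mul_of_nonneg_right ((hWle ρ k hρ0 hk.1 hk.2).trans ?_) (hg0 k)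
            calc c / ρ ^ 2 ≤ c / (1 / 2) ^ 2 :=
                  div_le_div_of_nonneg_left hc (by norm_num) (pow_le_pow_left₀ (by norm_num) hρ 2)
              _ = 4 * c := by ring
        _ = 4 * c * ∫ k in K Real.pi \ K ρ, g k := integral_const_mul _ _
        _ ≤ 4 * c * ∫ k in K Real.pi, g k := by
            refine mul_le_mul_of_nonneg_left ?_ (by positivity)
            exact setIntegral_mono_set (hgi _) (Eventually.of_forall fun k => hg0 k)
              (Eventually.of_forall fun k hk => hk.1)
        _ ≤ 4 * c * (C_T * N) := mul_le_mul_of_nonneg_left hT (by positivity)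
    have h2 : 0 ≤ 4 * c * (C_M * N) / ρ := by positivity
    linarith
  intro J
  induction J with
  | zero =>
      intro ρ hρ
      rw [pow_zero, mul_one] at hρ
      exact base ρ hρ
  | succ J ih =>
      intro ρ hρJ
      rcases le_or_gt (1 / 2 : ℝ) ρ with hρ | hρ
      · exact base ρ hρ
      · -- `ρ < 1/2`: split along `K_{2ρ}`, `2ρ ≤ 1`
        have hρ0 : 0 < ρ := lt_of_lt_of_le (by positivity) hρJ
        have h2ρ : 1 / 2 * (1 / 2) ^ J ≤ 2 * ρ := by
          rw [pow_succ] at hρJ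
          linarith
        have h2ρ1 : 2 * ρ ≤ 1 := by linarith
        -- the near part `(K_π ∖ K_ρ) ∩ K_{2ρ}`
        have hnear : ∫ k in (K Real.pi \ K ρ) ∩ K (2 * ρ), W k * g k
            ≤ c / ρ ^ 2 * (C_M * (2 * ρ) * N) := by
          have hS : MeasurableSet ((K Real.pi \ K ρ) ∩ K (2 * ρ)) :=
            ((hKm _).diff (hKm _)).inter (hKm _)
          calc ∫ k in (K Real.pi \ K ρ) ∩ K (2 * ρ), W k * g k
              ≤ ∫ k in (K Real.pi \ K ρ) ∩ K (2 * ρ), c / ρ ^ 2 * g k := by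
                refine setIntegral_mono_on (hfi _ (Set.inter_subset_left.trans Set.sdiff_subset))
                  (Integrable.const_mul ((hgi (2 * ρ)).mono_set Set.inter_subset_right) _) hS ?_
                intro k hk
                exact mul_le_mul_of_nonneg_right (hWle ρ k hρ0 hk.1.1 hk.1.2) (hg0 k)
            _ = c / ρ ^ 2 * ∫ k in (K Real.pi \ K ρ) ∩ K (2 * ρ), g k :=
                integral_const_mul _ _
            _ ≤ c / ρ ^ 2 * ∫ k in K (2 * ρ), g k := by
                refine mul_le_mul_of_nonneg_left ?_ (by positivity)
                exact setIntegral_mono_set (hgi _) (Eventually.of_forall fun k => hg0 k)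
                  (Eventually.of_forall fun k hk => hk.2)
            _ ≤ c / ρ ^ 2 * (C_M * (2 * ρ) * N) :=
                mul_le_mul_of_nonneg_left (hM (2 * ρ) (by positivity) h2ρ1) (by positivity)
        -- the far part `(K_π ∖ K_ρ) ∖ K_{2ρ} ⊆ K_π ∖ K_{2ρ}`: induction hypothesis
        have hfar : ∫ k in (K Real.pi \ K ρ) \ K (2 * ρ), W k * g k
            ≤ 4 * c * (C_M * N) / (2 * ρ) + 4 * c * (C_T * N) := by
          refine le_trans ?_ (ih (2 * ρ) h2ρ)
          exact setIntegral_mono_set (hfi _ Set.sdiff_subset) (Eventually.of_forall fun k => hf0 k)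
            (Eventually.of_forall fun k hk => ⟨hk.1.1, hk.2⟩)
        calc ∫ k in K Real.pi \ K ρ, W k * g k
            = (∫ k in (K Real.pi \ K ρ) ∩ K (2 * ρ), W k * g k)
                + ∫ k in (K Real.pi \ K ρ) \ K (2 * ρ), W k * g k :=
              (integral_inter_add_sdiff (hKm (2 * ρ)) (hfi _ Set.sdiff_subset)).symm
          _ ≤ c / ρ ^ 2 * (C_M * (2 * ρ) * N) + (4 * c * (C_M * N) / (2 * ρ) + 4 * c * (C_T * N)) :=
              add_le_add hnear hfar
          _ = 4 * c * (C_M * N) / ρ + 4 * c * (C_T * N) := by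
              field_simp
              ring

/-- The final bookkeeping of constants: with `c = π² P`, `4c C_M N/ρ₂ + 4c C_T N ≤ (40 C_M + 60 C_T) P N/ρ₂`
for `0 < ρ₂ ≤ 1`, `P, N, C_M, C_T ≥ 0` (`π² ≤ 10`). [folklore] -/
theorem spectralTailBound_arith {c P N C_M C_T ρ₂ : ℝ} (hc : c = Real.pi ^ 2 * P) (hP : 0 ≤ P)
    (hN : 0 ≤ N) (hCM : 0 ≤ C_M) (hCT : 0 ≤ C_T) (hρ₂ : 0 < ρ₂) (hρ₂1 : ρ₂ ≤ 1) :
    4 * c * (C_M * N) / ρ₂ + 4 * c * (C_T * N) ≤ (40 * C_M + 60 * C_T) * P / ρ₂ * N := by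
  have hπ : Real.pi ^ 2 ≤ 10 := by nlinarith [Real.pi_lt_d2, Real.pi_pos]
  subst hc
  have hYM : 0 ≤ P * (C_M * N) := by positivity
  have hYT : 0 ≤ P * (C_T * N) := by positivity
  have hA : 4 * (Real.pi ^ 2 * P) * (C_M * N) / ρ₂ ≤ 40 * (P * (C_M * N)) / ρ₂ :=
    div_le_div_of_nonneg_right (by nlinarith [mul_nonneg (sub_nonneg.2 hπ) hYM]) hρ₂.le
  have hB : 4 * (Real.pi ^ 2 * P) * (C_T * N) ≤ 60 * (P * (C_T * N)) / ρ₂ := by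
    rw [le_div_iff₀ hρ₂]
    nlinarith [mul_nonneg (sub_nonneg.2 hπ) (mul_nonneg hYT hρ₂.le),
      mul_nonneg hYT (sub_nonneg.2 hρ₂1)]
  calc 4 * (Real.pi ^ 2 * P) * (C_M * N) / ρ₂ + 4 * (Real.pi ^ 2 * P) * (C_T * N)
      ≤ 40 * (P * (C_M * N)) / ρ₂ + 60 * (P * (C_T * N)) / ρ₂ := add_le_add hA hB
    _ = (40 * C_M + 60 * C_T) * P / ρ₂ * N := by ring

/-! ### The registered stub -/

/-- **Stub D `stub_spectralTailBound` (the box block weight sees little spectral mass outside a small cube;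
Ising-free).**  If `g̃_L ≥ 0`, `∫_{K_ρ} g̃_L ≤ C_M ρ (2L+1)³` for `0 < ρ ≤ 1` and `∫_K g̃_L ≤ C_T (2L+1)³`, then for
`0 < ρ₂ ≤ 1`: `∫_{K ∖ K_{ρ₂}} (Σ_{x,x'∈Λ_R} cos k·(x'−x)) g̃_L ≤ (40 C_M + 60 C_T)(2R+1)⁴ ρ₂⁻¹ (2L+1)³`: away from
`K_ρ` the block weight `(∏_j D_R(k_j))²` is `≤ π²(2R+1)⁴/ρ²` (`abs_dirichletRowSum_le`,
`abs_dirichletRowSum_le_pi_div` in the coordinate carrying the sup norm), and a dyadic induction on the scale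
(`spectralTailBound_induction`) sums the shell contributions: mass `≤ C_M 2ρ (2L+1)³` on `K_{2ρ}` while
`2ρ ≤ 1`, `≤ C_T (2L+1)³` beyond. [folklore] -/
theorem stub_spectralTailBound :
    ∀ (G : Site 3 → ℝ) (C_M C_T : ℝ) (L R : ℕ) (ρ₂ : ℝ), 0 ≤ C_M → 0 ≤ C_T → 0 < ρ₂ → ρ₂ ≤ 1 →
      (∀ k : Fin 3 → ℝ, 0 ≤ (∑ z ∈ box 3 L, ∑ z' ∈ box 3 L, G (z' - z) * Real.cos (phase 3 k (z' - z)))) →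
      (∀ ρ : ℝ, 0 < ρ → ρ ≤ 1 →
        ∫ k in Set.pi Set.univ (fun _ : Fin 3 => Set.Icc (-ρ) ρ), (∑ z ∈ box 3 L, ∑ z' ∈ box 3 L, G (z' - z) * Real.cos (phase 3 k (z' - z))) ≤ C_M * ρ * (2 * L + 1) ^ 3) →
      (∫ k in Set.pi Set.univ (fun _ : Fin 3 => Set.Icc (-Real.pi) Real.pi), (∑ z ∈ box 3 L, ∑ z' ∈ box 3 L, G (z' - z) * Real.cos (phase 3 k (z' - z))) ≤ C_T * (2 * L + 1) ^ 3) →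
      ∫ k in Set.pi Set.univ (fun _ : Fin 3 => Set.Icc (-Real.pi) Real.pi) \ Set.pi Set.univ (fun _ : Fin 3 => Set.Icc (-ρ₂) ρ₂),
          (∑ x ∈ box 3 R, ∑ x' ∈ box 3 R, Real.cos (phase 3 k (x' - x))) * (∑ z ∈ box 3 L, ∑ z' ∈ box 3 L, G (z' - z) * Real.cos (phase 3 k (z' - z)))
        ≤ (40 * C_M + 60 * C_T) * (2 * R + 1) ^ 4 / ρ₂ * (2 * L + 1) ^ 3 := by
  intro G C_M C_T L R ρ₂ hCM hCT hρ₂ hρ₂1 hg0 hM hT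
  -- a dyadic scale below `ρ₂`
  obtain ⟨J, hJ⟩ := exists_pow_lt_of_lt_one hρ₂ (by norm_num : (1 / 2 : ℝ) < 1)
  have hJ' : 1 / 2 * (1 / 2 : ℝ) ^ J ≤ ρ₂ := by
    have h0 : (0 : ℝ) ≤ (1 / 2) ^ J := by positivity
    linarith [hJ.le]
  have key := spectralTailBound_induction
    (K := fun r : ℝ => Set.pi Set.univ (fun _ : Fin 3 => Set.Icc (-r) r))
    (W := fun k => ∑ x ∈ box 3 R, ∑ x' ∈ box 3 R, Real.cos (phase 3 k (x' - x)))
    (g := fun k => ∑ z ∈ box 3 L, ∑ z' ∈ box 3 L, G (z' - z) * Real.cos (phase 3 k (z' - z)))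
    (c := Real.pi ^ 2 * (2 * R + 1) ^ 4) (C_M := C_M) (C_T := C_T) (N := (2 * L + 1) ^ 3)
    (fun _ => MeasurableSet.univ_pi fun _ => measurableSet_Icc)
    (fun _ => isCompact_univ_pi fun _ => isCompact_Icc)
    (spectralTailBound_continuous_weight R) (spectralTailBound_continuous_density L G)
    (fun k => spectralBallMass_weight_nonneg R k) hg0 (by positivity) hCM (by positivity)
    (fun ρ k hρ hk hkρ => spectralTailBound_weight_le R hρ hk hkρ) hM hT J ρ₂ hJ'
  refine key.trans ?_
  exact spectralTailBound_arith rfl (by positivity) (by positivity) hCM hCT hρ₂ hρ₂1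

end Summit.CriticalPhenomena.Ising3DConformalLimit.Cruxes.DirectCorrelationStableTail.DiffusiveBranchIsNonsaturation
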